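import Literature.NumberTheory.Automorphic.ArithmeticQuotientHeckeTwoLevel
import Literature.NumberTheory.Automorphic.HidaTowerLevelsHecke
import HarnessLib

/-!
# Restriction and transfer between two levels: `tr ∘ res = [L : L']`, `res ∘ tr = N_{L/L'}`

Topic `NumberTheory/Automorphic`; namespaces `Literature.NumberTheory.Automorphic.ArithmeticQuotient`
(generic) and `Literature.NumberTheory.Automorphic.BigHeckeGLn.TameLevel` (the Hida levels
`U(b, c)` of `GL_n`); theorems only.  Proof file supporting the named fact
`Literature.NumberTheory.Automorphic.hidaControl_dominantOrdinaryPoint` (Hida's control theorem,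
[Hida1994AIF, Thm. 3.1–3.2], [KhareThorne2017, §6.3–6.5]): the restriction / transfer formalism by
which the cohomology at level `U(b', c)` controls the `U(b', c)/U(b, c)`-invariants of the cohomology
at level `U(b, c)` up to kernel and cokernel killed by the index ([Hida1994AIF, §2–3, "res … has
finite kernel and cokernel", via [Hida1993Duke, Thm. 5.1]]; [Brown1982CohomologyGroups, Ch. III,
Prop. 9.5 (ii), (iii) and Prop. 10.1]).

In the tree's model `H^i(X_L, M) = H^i(Γ, Fun(𝒢 ⧸ L, M))` (`ArithmeticQuotientCohomology`) the
covering `X_{L'} → X_L` (`L' ≤ L`) gives `res = cohomologyPullback` (pull-back of functions) and the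
transfer is the two-level Hecke operator of `g = 1`, `tr = [L 1 L'] = heckeOperator₂ k L L' 1`
(`ArithmeticQuotientHeckeTwoLevel`): `(tr f)(xL) = ∑_{yL' ⊆ L} f(x y L')`.  We prove, for every
`Γ`, `𝒢`, `k`, `M`:

* `map_id_add`, `map_id_sum`, `map_id_nsmul` — `H^n(Γ, -)` is additive in the morphism (Mathlib's
  `cochainsFunctor` is additive; bookkeeping);
* `doubleCosetQuot₂_one_eq_range`, `ncard_doubleCosetQuot₂_one` — `L 1 L' / L' = L / L'` has
  `[L : L'] = L'.relIndex L` elements (`0` when infinite);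
* **`tr ∘ res = [L : L']`** (`heckeFun₂_one_pullbackHom`, `pullbackHom_comp_heckeRepHom₂_one`,
  `cohomologyPullback_comp_heckeOperator₂_one`, `heckeOperator₂_one_cohomologyPullback_apply`)
  [Brown1982CohomologyGroups, Ch. III, Prop. 9.5 (ii)] — unconditionally, thanks to the matching junk
  values (`tr = 0` and `relIndex = 0` for infinite index); hence `ker res` is killed by `[L : L']`
  (`relIndex_smul_eq_zero_of_cohomologyPullback_eq_zero`, [Brown1982CohomologyGroups, Ch. III,
  Prop. 10.1]);
* for `L` normalising `L'`: `res` lands in the `L/L'`-invariants (`heckeEnd_cohomologyPullback_of_mem`: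
  `T_l ∘ res = res` for `l ∈ L`) and **`res ∘ tr = ∑_{s ∈ S} T_s`**, the norm element of `L/L'`
  acting through the (diamond) operators `T_s = [L' s L']`, for any transversal `S` of `L/L'`
  (`pullbackHom_heckeFun₂_one`, `heckeRepHom₂_one_comp_pullbackHom`,
  `heckeOperator₂_one_comp_cohomologyPullback`, `cohomologyPullback_heckeOperator₂_one_apply`)
  [Brown1982CohomologyGroups, Ch. III, Prop. 9.5 (iii)]; hence `[L : L'] • y ∈ range res` for every
  invariant class `y` (`relIndex_smul_mem_range_cohomologyPullback`) — kernel and cokernel of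
  `res : H^i(X_L, M) → H^i(X_{L'}, M)^{L/L'}` are killed by `[L : L']`;
* for `GL_n` over a number field and the two-parameter Hida levels: **`Iw_v(b, c) ⊴ Iw_v(b', c)` and
  `U(b, c) ⊴ U(b', c)` for `b' ≤ b ≤ c`** (`IwahoriCond.conj`, `conj_mem_valuedIwahoriSubgroup`,
  `TameLevel.conj_mem_level`; an ultrametric matrix computation), so all of the above applies to
  `res : H^i(X_{U(b',c)}, M) → H^i(X_{U(b,c)}, M)` (`TameLevel.heckeEnd_level_cohomologyPullback_of_mem`,
  `TameLevel.heckeOperator₂_one_comp_cohomologyPullback_level`,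
  `TameLevel.relIndex_smul_mem_range_cohomologyPullback_level`) — the action of
  `U(b', c)/U(b, c) ≅ T(b')/T(b)` of [KhareThorne2017, §6.3] through the diamond operators.

## References

* K. S. Brown, *Cohomology of Groups*, GTM 87, Springer (1982), Ch. III, §9, Prop. 9.5 (ii), (iii)
  (pp. 81–82) and §10, Prop. 10.1 (held; read 2026-08-16). [Brown1982CohomologyGroups]
* H. Hida, *p-adic ordinary Hecke algebras for GL(2)*, Ann. Inst. Fourier 44 (1994), §2 (proof of
  Thm. 2.2, p. 1299–1300) and §3 (held). [Hida1994AIF]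
* H. Hida, *p-ordinary cohomology groups for SL(2) over number fields*, Duke Math. J. 69 (1993),
  Thm. 5.1. [Hida1993Duke]
* C. Khare, J. A. Thorne, *Potential automorphy and the Leopoldt conjecture*, Amer. J. Math. 139
  (2017), §6.3 (arXiv:1409.7007, held). [KhareThorne2017]
-/

noncomputable section

open CategoryTheory
open scoped NumberField
open IsDedekindDomain

namespace Literature.NumberTheory.Automorphic

namespace ArithmeticQuotient

variable (k : Type) [CommRing k] {Γ 𝒢 : Type} [Group Γ] [Group 𝒢]

/-! ### `H^n(Γ, -)` is additive in the morphism -/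

section Additive

variable {k}
variable {A B : Rep k Γ}

/-- `H^n(Γ, φ + ψ) = H^n(Γ, φ) + H^n(Γ, ψ)`. [folklore] -/
theorem map_id_add (φ ψ : A ⟶ B) (n : ℕ) :
    groupCohomology.map (MonoidHom.id Γ) (φ + ψ) n =
      groupCohomology.map (MonoidHom.id Γ) φ n + groupCohomology.map (MonoidHom.id Γ) ψ n := by
  change HomologicalComplex.homologyMap ((groupCohomology.cochainsFunctor k Γ).map (φ + ψ)) n =
    HomologicalComplex.homologyMap ((groupCohomology.cochainsFunctor k Γ).map φ) n +
      HomologicalComplex.homologyMap ((groupCohomology.cochainsFunctor k Γ).map ψ) n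
  rw [Functor.map_add, HomologicalComplex.homologyMap_add]

/-- `H^n(Γ, 0) = 0` on morphisms. [folklore] -/
theorem map_id_zero (n : ℕ) : groupCohomology.map (MonoidHom.id Γ) (0 : A ⟶ B) n = 0 := by
  change HomologicalComplex.homologyMap ((groupCohomology.cochainsFunctor k Γ).map 0) n = 0
  rw [Functor.map_zero, HomologicalComplex.homologyMap_zero]

/-- `H^n(Γ, ∑ φ_j) = ∑ H^n(Γ, φ_j)`. [folklore] -/
theorem map_id_sum {J : Type*} (s : Finset J) (φ : J → (A ⟶ B)) (n : ℕ) :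
    groupCohomology.map (MonoidHom.id Γ) (∑ j ∈ s, φ j) n =
      ∑ j ∈ s, groupCohomology.map (MonoidHom.id Γ) (φ j) n := by
  classical
  induction s using Finset.induction_on with
  | empty => rw [Finset.sum_empty, Finset.sum_empty, map_id_zero]
  | insert j s hj ih => rw [Finset.sum_insert hj, Finset.sum_insert hj, map_id_add, ih]

/-- `H^n(Γ, m • φ) = m • H^n(Γ, φ)`. [folklore] -/
theorem map_id_nsmul (m : ℕ) (φ : A ⟶ B) (n : ℕ) :
    groupCohomology.map (MonoidHom.id Γ) (m • φ) n = m • groupCohomology.map (MonoidHom.id Γ) φ n := by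
  induction m with
  | zero => rw [zero_nsmul, zero_nsmul, map_id_zero]
  | succ m ih => rw [succ_nsmul, succ_nsmul, map_id_add, ih]

end Additive

/-! ### The orbit `L 1 L' / L' = L / L'` -/

section Orbit

variable {k}
variable (L L' : Subgroup 𝒢)

omit [Group Γ] in
/-- `L 1 L' / L' ⊆ 𝒢 ⧸ L'` is the image of `L`. [folklore] -/
theorem doubleCosetQuot₂_one_eq_range :
    doubleCosetQuot₂ L L' (1 : 𝒢) = Set.range fun l : L => ((l : 𝒢) : 𝒢 ⧸ L') := by
  ext d
  simp only [doubleCosetQuot₂, MulAction.mem_orbit_iff, Set.mem_range]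
  refine exists_congr fun l => ?_
  change (l : 𝒢) • ((1 : 𝒢) : 𝒢 ⧸ L') = d ↔ _
  rw [MulAction.Quotient.smul_coe, smul_eq_mul, mul_one]

omit [Group Γ] in
/-- The stabiliser in `L` of the base point `L' ∈ 𝒢 ⧸ L'` is `L ∩ L'`. [folklore] -/
theorem stabilizer_mk_one : MulAction.stabilizer L ((1 : 𝒢) : 𝒢 ⧸ L') = L'.subgroupOf L := by
  ext l
  rw [MulAction.mem_stabilizer_iff, Subgroup.mem_subgroupOf]
  change (l : 𝒢) • ((1 : 𝒢) : 𝒢 ⧸ L') = ((1 : 𝒢) : 𝒢 ⧸ L') ↔ _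
  rw [MulAction.Quotient.smul_coe, smul_eq_mul, mul_one, QuotientGroup.eq, mul_one, inv_mem_iff]

omit [Group Γ] in
/-- **`#(L 1 L' / L') = [L : L ∩ L']`** (`Subgroup.relIndex`; both sides are `0` when infinite).
[folklore] -/
theorem ncard_doubleCosetQuot₂_one : (doubleCosetQuot₂ L L' (1 : 𝒢)).ncard = L'.relIndex L := by
  rw [Subgroup.relIndex, ← stabilizer_mk_one, MulAction.index_stabilizer]
  rfl

omit [Group Γ] in
variable {L L'} in
/-- A finite transversal of `L 1 L' / L'` has `[L : L ∩ L']` elements. [folklore] -/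
theorem card_eq_relIndex_of_bijOn {S : Finset 𝒢}
    (hS : Set.BijOn (fun s : 𝒢 => (s : 𝒢 ⧸ L')) S (doubleCosetQuot₂ L L' 1)) :
    S.card = L'.relIndex L := by
  rw [← ncard_doubleCosetQuot₂_one, ← hS.image_eq, hS.injOn.ncard_image,
    Set.ncard_coe_finset]

omit [Group Γ] in
variable {L L'} in
/-- The elements of a transversal of `L 1 L' / L'` lie in `L` when `L' ≤ L`. [folklore] -/
theorem mem_of_bijOn (h : L' ≤ L) {S : Finset 𝒢}
    (hS : Set.BijOn (fun s : 𝒢 => (s : 𝒢 ⧸ L')) S (doubleCosetQuot₂ L L' 1)) {s : 𝒢} (hs : s ∈ S) :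
    s ∈ L := by
  have hs' : (s : 𝒢 ⧸ L') ∈ doubleCosetQuot₂ L L' 1 := hS.mapsTo (Finset.mem_coe.2 hs)
  rw [doubleCosetQuot₂_one_eq_range] at hs'
  obtain ⟨l, hl⟩ := hs'
  have hls : (l : 𝒢)⁻¹ * s ∈ L' := QuotientGroup.eq.1 hl
  simpa using mul_mem l.2 (h hls)

end Orbit

/-! ### `tr ∘ res = [L : L']` -/

section Transfer

variable (L L' : Subgroup 𝒢) (M : Type) [AddCommGroup M] [Module k M] (ι : Γ →* 𝒢)

/-- **`tr ∘ res = [L : L']` on functions**: `[L 1 L'] (f ∘ π) = [L : L'] • f` for `L' ≤ L`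
(both sides vanish when the index is infinite). [cite: Brown1982CohomologyGroups, Ch. III, Prop. 9.5 (ii)] -/
theorem heckeFun₂_one_pullbackHom (h : L' ≤ L) (f : 𝒢 ⧸ L → M) :
    heckeFun₂ k L L' 1 M ((pullbackHom k ι M h).hom f) = L'.relIndex L • f := by
  classical
  funext c
  by_cases hfin : (doubleCosetQuot₂ L L' (1 : 𝒢)).Finite
  · induction c using QuotientGroup.induction_on with
    | H x =>
      rw [heckeFun₂_apply_coe k L L' 1 M _ x hfin, Pi.smul_apply]
      have key : ∀ d ∈ hfin.toFinset, (pullbackHom k ι M h).hom f (x • d) = f (x : 𝒢 ⧸ L) := by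
        intro d hd
        rw [Set.Finite.mem_toFinset, doubleCosetQuot₂_one_eq_range] at hd
        obtain ⟨l, rfl⟩ := hd
        rw [MulAction.Quotient.smul_coe, smul_eq_mul, pullbackHom_apply,
          Subgroup.quotientMapOfLE_apply_mk]
        congr 1
        exact QuotientGroup.eq.2 (by simp)
      rw [Finset.sum_congr rfl key, Finset.sum_const, ← Set.ncard_eq_toFinset_card _ hfin,
        ncard_doubleCosetQuot₂_one]
  · rw [heckeFun₂_eq_zero_of_infinite k L L' 1 M hfin, LinearMap.zero_apply, Pi.zero_apply,
      Pi.smul_apply, ← ncard_doubleCosetQuot₂_one, Set.Infinite.ncard hfin, zero_nsmul]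

/-- `tr ∘ res = [L : L']` on the coefficient representations. [cite: Brown1982CohomologyGroups, Ch. III, Prop. 9.5 (ii)] -/
theorem pullbackHom_comp_heckeRepHom₂_one (h : L' ≤ L) :
    pullbackHom k ι M h ≫ heckeRepHom₂ k L L' 1 M ι = L'.relIndex L • 𝟙 (coeffRep k ι L M) :=
  Rep.hom_ext (Representation.IntertwiningMap.ext (LinearMap.ext fun f => by
    change heckeFun₂ k L L' 1 M ((pullbackHom k ι M h).hom f) = L'.relIndex L • f
    exact heckeFun₂_one_pullbackHom k L L' M ι h f))

/-- **`tr ∘ res = [L : L']` on `H^i(X_L, M)`**: the composite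
`H^i(X_L, M) → H^i(X_{L'}, M) → H^i(X_L, M)` of the pull-back and the transfer `[L 1 L']` is
multiplication by the index. [cite: Brown1982CohomologyGroups, Ch. III, Prop. 9.5 (ii)] -/
theorem cohomologyPullback_comp_heckeOperator₂_one (h : L' ≤ L) (i : ℕ) :
    cohomologyPullback k ι M h i ≫ heckeOperator₂ k L L' 1 M ι i =
      L'.relIndex L • 𝟙 (cohomology k ι L M i) := by
  rw [cohomologyPullback, heckeOperator₂, ← groupCohomology.map_id_comp,
    pullbackHom_comp_heckeRepHom₂_one, map_id_nsmul, groupCohomology.map_id]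

/-- `tr (res x) = [L : L'] • x` for `x ∈ H^i(X_L, M)`. [cite: Brown1982CohomologyGroups, Ch. III, Prop. 9.5 (ii)] -/
theorem heckeOperator₂_one_cohomologyPullback_apply (h : L' ≤ L) (i : ℕ) (x : cohomology k ι L M i) :
    (heckeOperator₂ k L L' 1 M ι i).hom ((cohomologyPullback k ι M h i).hom x) = L'.relIndex L • x := by
  have h' := congrArg ModuleCat.Hom.hom (cohomologyPullback_comp_heckeOperator₂_one k L L' M ι h i)
  rw [ModuleCat.hom_comp, ModuleCat.hom_nsmul, ModuleCat.hom_id] at h'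
  simpa using LinearMap.congr_fun h' x

/-- **The kernel of `res : H^i(X_L, M) → H^i(X_{L'}, M)` is killed by `[L : L']`.**
[cite: Brown1982CohomologyGroups, Ch. III, Prop. 10.1] -/
theorem relIndex_smul_eq_zero_of_cohomologyPullback_eq_zero (h : L' ≤ L) (i : ℕ)
    {x : cohomology k ι L M i} (hx : (cohomologyPullback k ι M h i).hom x = 0) :
    L'.relIndex L • x = 0 := by
  rw [← heckeOperator₂_one_cohomologyPullback_apply k L L' M ι h i x, hx, map_zero]

/-! ### `res` lands in the invariants; `res ∘ tr = N_{L/L'}` -/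

variable {L L'} in
/-- For `l ∈ L` normalising `L'`: `T_l (f ∘ π) = f ∘ π` — the pull-back lands in the
`L/L'`-invariants. [folklore] -/
theorem heckeFun_pullbackHom_of_mem (h : L' ≤ L) {l : 𝒢} (hl : l ∈ L)
    (hlN : ∀ y ∈ L', l⁻¹ * y * l ∈ L') (f : 𝒢 ⧸ L → M) :
    heckeFun k L' l M ((pullbackHom k ι M h).hom f) = (pullbackHom k ι M h).hom f := by
  funext c
  induction c using QuotientGroup.induction_on with
  | H x =>
    rw [heckeFun_apply_mk_of_conj k M hlN, pullbackHom_apply, pullbackHom_apply,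
      Subgroup.quotientMapOfLE_apply_mk, Subgroup.quotientMapOfLE_apply_mk]
    congr 1
    exact QuotientGroup.eq.2 (by simpa using inv_mem hl)

variable {L L'} in
/-- `res ≫ T_l = res` on the coefficient representations, for `l ∈ L` normalising `L'`. [folklore] -/
theorem pullbackHom_comp_heckeRepHom_of_mem (h : L' ≤ L) {l : 𝒢} (hl : l ∈ L)
    (hlN : ∀ y ∈ L', l⁻¹ * y * l ∈ L') :
    pullbackHom k ι M h ≫ heckeRepHom k L' l M ι = pullbackHom k ι M h :=
  Rep.hom_ext (Representation.IntertwiningMap.ext (LinearMap.ext fun f => by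
    change heckeFun k L' l M ((pullbackHom k ι M h).hom f) = (pullbackHom k ι M h).hom f
    exact heckeFun_pullbackHom_of_mem k M ι h hl hlN f))

variable {L L'} in
/-- **`res : H^i(X_L, M) → H^i(X_{L'}, M)` lands in the `L/L'`-invariants**: `T_l ∘ res = res` for
`l ∈ L` normalising `L'`. [cite: Brown1982CohomologyGroups, Ch. III, §9, Exercise 1 and Prop. 10.4] -/
theorem cohomologyPullback_comp_heckeOperator_of_mem (h : L' ≤ L) {l : 𝒢} (hl : l ∈ L)
    (hlN : ∀ y ∈ L', l⁻¹ * y * l ∈ L') (i : ℕ) :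
    cohomologyPullback k ι M h i ≫ heckeOperator k L' l M ι i = cohomologyPullback k ι M h i := by
  rw [cohomologyPullback, heckeOperator, ← groupCohomology.map_id_comp,
    pullbackHom_comp_heckeRepHom_of_mem k M ι h hl hlN]

variable {L L'} in
/-- `T_l (res x) = res x` for `l ∈ L` normalising `L'`. [folklore] -/
theorem heckeEnd_cohomologyPullback_of_mem (h : L' ≤ L) {l : 𝒢} (hl : l ∈ L)
    (hlN : ∀ y ∈ L', l⁻¹ * y * l ∈ L') (i : ℕ) (x : cohomology k ι L M i) :
    heckeEnd k L' l M ι i ((cohomologyPullback k ι M h i).hom x) = (cohomologyPullback k ι M h i).hom x := by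
  have h' := congrArg ModuleCat.Hom.hom (cohomologyPullback_comp_heckeOperator_of_mem k M ι h hl hlN i)
  rw [ModuleCat.hom_comp] at h'
  exact LinearMap.congr_fun h' x

/-- **`res ∘ tr = ∑_{s ∈ S} T_s` on functions** (`L` normalising `L' ≤ L`, `S` a transversal of
`L / L'`): `([L 1 L'] f) ∘ π = ∑_{s ∈ S} [L' s L'] f`, the norm element of `L/L'`.
[cite: Brown1982CohomologyGroups, Ch. III, Prop. 9.5 (iii)] -/
theorem pullbackHom_heckeFun₂_one (h : L' ≤ L) (hN : ∀ l ∈ L, ∀ y ∈ L', l⁻¹ * y * l ∈ L')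
    (S : Finset 𝒢) (hS : Set.BijOn (fun s : 𝒢 => (s : 𝒢 ⧸ L')) S (doubleCosetQuot₂ L L' 1))
    (f : 𝒢 ⧸ L' → M) :
    (pullbackHom k ι M h).hom (heckeFun₂ k L L' 1 M f) = ∑ s ∈ S, heckeFun k L' s M f := by
  classical
  have hfin : (doubleCosetQuot₂ L L' (1 : 𝒢)).Finite := by
    rw [← hS.image_eq]
    exact S.finite_toSet.image _
  funext c
  induction c using QuotientGroup.induction_on with
  | H x =>
    rw [pullbackHom_apply, Subgroup.quotientMapOfLE_apply_mk,
      heckeFun₂_apply_coe k L L' 1 M f x hfin, Finset.sum_apply,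
      Finset.sum_congr rfl fun s hs =>
        heckeFun_apply_mk_of_conj k M (hN s (mem_of_bijOn h hS hs)) f x]
    symm
    refine Finset.sum_nbij (fun s : 𝒢 => (s : 𝒢 ⧸ L')) (fun s hs => ?_) hS.injOn (fun d hd => ?_)
      fun s _ => by rw [MulAction.Quotient.smul_coe, smul_eq_mul]
    · rw [Set.Finite.mem_toFinset]
      exact hS.mapsTo (Finset.mem_coe.2 hs)
    · rw [Set.Finite.coe_toFinset] at hd
      exact hS.surjOn hd

/-- `res ∘ tr = ∑_{s ∈ S} T_s` on the coefficient representations. [cite: Brown1982CohomologyGroups, Ch. III, Prop. 9.5 (iii)] -/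
theorem heckeRepHom₂_one_comp_pullbackHom (h : L' ≤ L) (hN : ∀ l ∈ L, ∀ y ∈ L', l⁻¹ * y * l ∈ L')
    (S : Finset 𝒢) (hS : Set.BijOn (fun s : 𝒢 => (s : 𝒢 ⧸ L')) S (doubleCosetQuot₂ L L' 1)) :
    heckeRepHom₂ k L L' 1 M ι ≫ pullbackHom k ι M h = ∑ s ∈ S, heckeRepHom k L' s M ι :=
  Rep.hom_ext (Representation.IntertwiningMap.ext (LinearMap.ext fun f => by
    change (pullbackHom k ι M h).hom (heckeFun₂ k L L' 1 M f) = _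
    rw [pullbackHom_heckeFun₂_one k L L' M ι h hN S hS f, Rep.sum_hom,
      Representation.IntertwiningMap.toLinearMap_sum, LinearMap.sum_apply]
    rfl))

/-- **`res ∘ tr = ∑_{s ∈ S} T_s` on `H^i(X_{L'}, M)`**: for `L` normalising `L' ≤ L` and a
transversal `S` of `L/L'`, the composite `H^i(X_{L'}, M) → H^i(X_L, M) → H^i(X_{L'}, M)` of the
transfer and the pull-back is the norm `∑_{s ∈ S} T_s` of the action of `L/L'` by the (diamond)
operators `T_s = [L' s L']`. [cite: Brown1982CohomologyGroups, Ch. III, Prop. 9.5 (iii)] -/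
theorem heckeOperator₂_one_comp_cohomologyPullback (h : L' ≤ L)
    (hN : ∀ l ∈ L, ∀ y ∈ L', l⁻¹ * y * l ∈ L') (S : Finset 𝒢)
    (hS : Set.BijOn (fun s : 𝒢 => (s : 𝒢 ⧸ L')) S (doubleCosetQuot₂ L L' 1)) (i : ℕ) :
    heckeOperator₂ k L L' 1 M ι i ≫ cohomologyPullback k ι M h i =
      ∑ s ∈ S, heckeOperator k L' s M ι i := by
  rw [heckeOperator₂, cohomologyPullback, ← groupCohomology.map_id_comp,
    heckeRepHom₂_one_comp_pullbackHom k L L' M ι h hN S hS, map_id_sum]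

/-- `res (tr x) = ∑_{s ∈ S} T_s x` for `x ∈ H^i(X_{L'}, M)`. [cite: Brown1982CohomologyGroups, Ch. III, Prop. 9.5 (iii)] -/
theorem cohomologyPullback_heckeOperator₂_one_apply (h : L' ≤ L)
    (hN : ∀ l ∈ L, ∀ y ∈ L', l⁻¹ * y * l ∈ L') (S : Finset 𝒢)
    (hS : Set.BijOn (fun s : 𝒢 => (s : 𝒢 ⧸ L')) S (doubleCosetQuot₂ L L' 1)) (i : ℕ)
    (x : cohomology k ι L' M i) :
    (cohomologyPullback k ι M h i).hom ((heckeOperator₂ k L L' 1 M ι i).hom x) =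
      ∑ s ∈ S, heckeEnd k L' s M ι i x := by
  have h' := congrArg ModuleCat.Hom.hom
    (heckeOperator₂_one_comp_cohomologyPullback k L L' M ι h hN S hS i)
  rw [ModuleCat.hom_comp, ModuleCat.hom_sum] at h'
  have h'' := LinearMap.congr_fun h' x
  rw [LinearMap.comp_apply, LinearMap.sum_apply] at h''
  exact h''

/-- The norm `∑_{s ∈ S} T_s x` of any class `x ∈ H^i(X_{L'}, M)` lies in the image of `res`.
[cite: Brown1982CohomologyGroups, Ch. III, Prop. 9.5 (iii)] -/
theorem sum_heckeEnd_mem_range_cohomologyPullback (h : L' ≤ L)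
    (hN : ∀ l ∈ L, ∀ y ∈ L', l⁻¹ * y * l ∈ L') (S : Finset 𝒢)
    (hS : Set.BijOn (fun s : 𝒢 => (s : 𝒢 ⧸ L')) S (doubleCosetQuot₂ L L' 1)) (i : ℕ)
    (x : cohomology k ι L' M i) :
    ∑ s ∈ S, heckeEnd k L' s M ι i x ∈ LinearMap.range (cohomologyPullback k ι M h i).hom :=
  ⟨(heckeOperator₂ k L L' 1 M ι i).hom x,
    cohomologyPullback_heckeOperator₂_one_apply k L L' M ι h hN S hS i x⟩

/-- **The cokernel of `res : H^i(X_L, M) → H^i(X_{L'}, M)^{L/L'}` is killed by `[L : L']`**: for an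
`L/L'`-invariant class `y` (`T_s y = y` for the transversal `S`), `[L : L'] • y = res (tr y)`.
[cite: Brown1982CohomologyGroups, Ch. III, Prop. 9.5 (iii) and Prop. 10.4] -/
theorem relIndex_smul_mem_range_cohomologyPullback (h : L' ≤ L)
    (hN : ∀ l ∈ L, ∀ y ∈ L', l⁻¹ * y * l ∈ L') (S : Finset 𝒢)
    (hS : Set.BijOn (fun s : 𝒢 => (s : 𝒢 ⧸ L')) S (doubleCosetQuot₂ L L' 1)) (i : ℕ)
    {y : cohomology k ι L' M i} (hy : ∀ s ∈ S, heckeEnd k L' s M ι i y = y) :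
    L'.relIndex L • y ∈ LinearMap.range (cohomologyPullback k ι M h i).hom := by
  have hsum : ∑ s ∈ S, heckeEnd k L' s M ι i y = L'.relIndex L • y := by
    rw [Finset.sum_congr rfl hy, Finset.sum_const, card_eq_relIndex_of_bijOn hS]
  rw [← hsum]
  exact sum_heckeEnd_mem_range_cohomologyPullback k L L' M ι h hN S hS i y

omit [Group Γ] in
variable {L'} in
/-- The operator `T_s = [L' s L']` of an element normalising `L'` depends only on the coset `s L'`
(so the norm `∑_{s ∈ S} T_s` does not depend on the transversal). [folklore] -/
theorem heckeFun_eq_of_coe_eq {s s' : 𝒢} (hs : ∀ y ∈ L', s⁻¹ * y * s ∈ L')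
    (hs' : ∀ y ∈ L', s'⁻¹ * y * s' ∈ L') (hss' : (s : 𝒢 ⧸ L') = s') :
    heckeFun k L' s M = heckeFun k L' s' M := by
  refine LinearMap.ext fun f => funext fun c => ?_
  induction c using QuotientGroup.induction_on with
  | H x =>
    rw [heckeFun_apply_mk_of_conj k M hs, heckeFun_apply_mk_of_conj k M hs',
      ← smul_eq_mul x s, ← smul_eq_mul x s', ← MulAction.Quotient.smul_coe,
      ← MulAction.Quotient.smul_coe, hss']

variable {L'} in
/-- `T_s = T_{s'}` on `H^i(X_{L'}, M)` when `s L' = s' L'` (both normalising `L'`). [folklore] -/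
theorem heckeEnd_eq_of_coe_eq {s s' : 𝒢} (hs : ∀ y ∈ L', s⁻¹ * y * s ∈ L')
    (hs' : ∀ y ∈ L', s'⁻¹ * y * s' ∈ L') (hss' : (s : 𝒢 ⧸ L') = s') (i : ℕ) :
    heckeEnd k L' s M ι i = heckeEnd k L' s' M ι i := by
  have hrep : heckeRepHom k L' s M ι = heckeRepHom k L' s' M ι :=
    Rep.hom_ext (Representation.IntertwiningMap.ext (heckeFun_eq_of_coe_eq k M hs hs' hss'))
  rw [heckeEnd, heckeOperator, hrep]

end Transfer

end ArithmeticQuotient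

/-! ### `Iw(b, c) ⊴ Iw(b', c)` for `b' ≤ b ≤ c` -/

section ValuedIwahori

variable {F Γ₀ : Type*} [Field F] [LinearOrderedCommGroupWithZero Γ₀] [Valued F Γ₀]
  {m : Type*} [Fintype m] [DecidableEq m] [LinearOrder m]

/-- The diagonal estimate behind `Iw(β, γ) ⊴ Iw(β', γ)` (`γ ≤ β ≤ β'`): for `l, l'` satisfying the
Iwahori conditions of radii `(β', γ)` with `l' l = 1` and `x` those of radii `(β, γ)`, the diagonal
entries of `l' x l` are `≡ 1` modulo the ball of radius `β` (ultrametric estimate of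
`(l' (x - 1) l)_{ii} = ∑_{j,k} l'_{ij} (x - 1)_{jk} l_{ki}`: a factor of valuation `≤ β` is
`l'_{ij}` for `j < i`, `(x - 1)_{jk}` for `k ≤ j`, and `l_{ki}` for `k > j ≥ i`). [folklore] -/
theorem IwahoriCond.valued_conj_diag_sub_one_le {β β' γ : Γ₀} (hγβ : γ ≤ β)
    {l l' x : Matrix m m F} (hl : IwahoriCond m β' γ l) (hl' : IwahoriCond m β' γ l')
    (hl'l : l' * l = 1) (hx : IwahoriCond m β γ x) (i : m) :
    Valued.v ((l' * x * l) i i - 1) ≤ β := by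
  -- `l' x l - 1 = l' (x - 1) l`
  have hmat : l' * x * l - 1 = l' * (x - 1) * l := by
    rw [mul_sub, sub_mul, mul_one, hl'l]
  have hent : (l' * x * l) i i - 1 = (l' * (x - 1) * l) i i := by
    have := congrFun (congrFun hmat i) i
    rwa [Matrix.sub_apply, Matrix.one_apply_eq] at this
  -- entries of `y = x - 1`
  have hy_le_one : ∀ j k', Valued.v ((x - 1) j k') ≤ 1 := fun j k' => by
    rw [Matrix.sub_apply]
    refine (Valued.v.map_sub _ _).trans (max_le (hx.le_one j k') ?_)
    rw [Matrix.one_apply]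
    split_ifs <;> simp
  have hy_lower : ∀ j k', k' ≤ j → Valued.v ((x - 1) j k') ≤ β := fun j k' hk' => by
    rcases hk'.lt_or_eq with hlt | rfl
    · rw [Matrix.sub_apply, Matrix.one_apply_ne (ne_of_gt hlt), sub_zero]
      exact (hx.lower j k' hlt).trans (min_le_left _ _)
    · rw [Matrix.sub_apply, Matrix.one_apply_eq]
      exact hx.diag _
  rw [hent, Matrix.mul_apply]
  refine Valued.v.map_sum_le fun k' _ => ?_
  rw [Matrix.mul_apply, Finset.sum_mul]
  refine Valued.v.map_sum_le fun j _ => ?_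
  rw [map_mul, map_mul]
  -- the term `l'_{ij} y_{jk'} l_{k'i}`
  rcases lt_or_ge j i with hji | hij
  · -- `j < i`: `|l'_{ij}| ≤ min β' γ ≤ γ ≤ β`
    calc Valued.v (l' i j) * Valued.v ((x - 1) j k') * Valued.v (l k' i)
        ≤ β * 1 * 1 :=
          mul_le_mul' (mul_le_mul' (((hl'.lower i j hji).trans (min_le_right _ _)).trans hγβ)
            (hy_le_one j k')) (hl.le_one k' i)
      _ = β := by rw [mul_one, mul_one]
  · rcases le_or_gt k' j with hkj | hjk
    · -- `k' ≤ j`: `|y_{jk'}| ≤ β`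
      calc Valued.v (l' i j) * Valued.v ((x - 1) j k') * Valued.v (l k' i)
          ≤ 1 * β * 1 := mul_le_mul' (mul_le_mul' (hl'.le_one i j) (hy_lower j k' hkj)) (hl.le_one k' i)
        _ = β := by rw [one_mul, mul_one]
    · -- `k' > j ≥ i`: `|l_{k'i}| ≤ min β' γ ≤ γ ≤ β`
      calc Valued.v (l' i j) * Valued.v ((x - 1) j k') * Valued.v (l k' i)
          ≤ 1 * 1 * β :=
            mul_le_mul' (mul_le_mul' (hl'.le_one i j) (hy_le_one j k'))
              (((hl.lower k' i (hij.trans_lt hjk)).trans (min_le_right _ _)).trans hγβ)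
        _ = β := by rw [one_mul, one_mul]

/-- **The Iwahori conditions of radii `(β, γ)` are stable under conjugation by `Iw(β', γ)` for
`γ ≤ β ≤ β'`.** [folklore] -/
theorem IwahoriCond.conj {β β' γ : Γ₀} (hγβ : γ ≤ β) (hββ' : β ≤ β')
    {l l' x : Matrix m m F} (hl : IwahoriCond m β' γ l) (hl' : IwahoriCond m β' γ l')
    (hl'l : l' * l = 1) (hx : IwahoriCond m β γ x) : IwahoriCond m β γ (l' * x * l) := by
  have hprod : IwahoriCond m β' γ (l' * x * l) := (hl'.mul (hx.anti hββ' le_rfl)).mul hl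
  refine ⟨hprod.le_one, fun i j hij => ?_,
    IwahoriCond.valued_conj_diag_sub_one_le hγβ hl hl' hl'l hx⟩
  calc Valued.v ((l' * x * l) i j) ≤ min β' γ := hprod.lower i j hij
    _ = γ := min_eq_right (hγβ.trans hββ')
    _ = min β γ := (min_eq_right hγβ).symm

/-- **`Iw(β, γ) ⊴ Iw(β', γ)` for `γ ≤ β ≤ β'`**: `l⁻¹ x l ∈ Iw(β, γ)` for `l ∈ Iw(β', γ)`,
`x ∈ Iw(β, γ)` (e.g. `Iw_v(b, c) ⊴ Iw_v(b', c)` for `b' ≤ b ≤ c`, with quotient `≅ T(b')/T(b)` via the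
diagonal entries). [cite: KhareThorne2017, §6.3 (U(b,c) ⊂ U(1,c) normal)] -/
theorem conj_mem_valuedIwahoriSubgroup {β β' γ : Γ₀} (hγβ : γ ≤ β) (hββ' : β ≤ β')
    {l x : GL m F} (hl : l ∈ valuedIwahoriSubgroup m β' γ) (hx : x ∈ valuedIwahoriSubgroup m β γ) :
    l⁻¹ * x * l ∈ valuedIwahoriSubgroup m β γ := by
  rw [mem_valuedIwahoriSubgroup_iff] at hl hx ⊢
  have hinv : ((l⁻¹ : GL m F) : Matrix m m F) * (l : Matrix m m F) = 1 := Units.inv_mul l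
  refine ⟨?_, ?_⟩
  · rw [Units.val_mul, Units.val_mul]
    exact IwahoriCond.conj hγβ hββ' hl.1 hl.2 hinv hx.1
  · rw [show (l⁻¹ * x * l)⁻¹ = l⁻¹ * x⁻¹ * l by group, Units.val_mul, Units.val_mul]
    exact IwahoriCond.conj hγβ hββ' hl.1 hl.2 hinv hx.2

end ValuedIwahori

/-! ### The Hida levels: `U(b, c) ⊴ U(b', c)` for `b' ≤ b ≤ c`, and the transfer -/

namespace BigHeckeGLn.TameLevel

variable {n : ℕ} {K : Type} [Field K] [NumberField K] {p : ℕ} [Fact p.Prime] (𝒰 : TameLevel n K p)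

omit [Fact p.Prime] 𝒰 in
/-- `Iw_v(b, c) ⊴ Iw_v(b', c)` for `b' ≤ b ≤ c`. [cite: KhareThorne2017, §6.3] -/
theorem conj_mem_iwahoriLevel (v : HeightOneSpectrum (𝓞 K)) {b b' c : ℕ} (hb : b' ≤ b) (hbc : b ≤ c)
    {l x : GL (Fin n) (v.adicCompletion K)} (hl : l ∈ iwahoriLevel n v b' c)
    (hx : x ∈ iwahoriLevel n v b c) : l⁻¹ * x * l ∈ iwahoriLevel n v b c :=
  conj_mem_valuedIwahoriSubgroup
    (WithZero.exp_le_exp.2 (neg_le_neg (Int.ofNat_le.2 hbc)))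
    (WithZero.exp_le_exp.2 (neg_le_neg (Int.ofNat_le.2 hb))) hl hx

/-- **`U(b, c) ⊴ U(b', c)` for `b' ≤ b ≤ c`**: the two-parameter Hida level `U(b, c)` is normalised
by `U(b', c)` (quotient `U(b', c)/U(b, c) ≅ ∏_{v ∣ p} T_v(b')/T_v(b)`, acting on `H^•(X_{U(b,c)}, M)`
through the diamond operators). [cite: KhareThorne2017, §6.3] -/
theorem conj_mem_level {b b' c : ℕ} (hb : b' ≤ b) (hbc : b ≤ c) {l x : FiniteAdelicGL n K}
    (hl : l ∈ 𝒰.level b' c) (hx : x ∈ 𝒰.level b c) : l⁻¹ * x * l ∈ 𝒰.level b c := by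
  rw [mem_level_iff] at hl hx ⊢
  refine ⟨mul_mem (mul_mem (inv_mem hl.1) hx.1) hl.1, fun w hw => ?_⟩
  rw [map_mul, map_mul, map_inv]
  exact conj_mem_iwahoriLevel w hb hbc (hl.2 w hw) (hx.2 w hw)

variable (k : Type) [CommRing k] (M : Type) [AddCommGroup M] [Module k M]

/-- **`res : H^i(X_{U(b',c)}, M) → H^i(X_{U(b,c)}, M)` lands in the `U(b',c)/U(b,c)`-invariants**
(`b' ≤ b ≤ c`): `T_l ∘ res = res` for every `l ∈ U(b', c)` — in particular for the diamond
operators `⟨u⟩_v`, `u ≡ 1 mod ϖ_v^{b'}`. [cite: KhareThorne2017, §6.3] -/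
theorem heckeEnd_level_cohomologyPullback_of_mem {b b' c : ℕ} (hb : b' ≤ b) (hbc : b ≤ c)
    {l : FiniteAdelicGL n K} (hl : l ∈ 𝒰.level b' c) (i : ℕ)
    (x : ArithmeticQuotient.cohomology k (globalEmbedding n K) (𝒰.level b' c) M i) :
    ArithmeticQuotient.heckeEnd k (𝒰.level b c) l M (globalEmbedding n K) i
        ((ArithmeticQuotient.cohomologyPullback k (globalEmbedding n K) M
          (𝒰.level_antitone hb le_rfl) i).hom x) =
      (ArithmeticQuotient.cohomologyPullback k (globalEmbedding n K) M
        (𝒰.level_antitone hb le_rfl) i).hom x :=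
  ArithmeticQuotient.heckeEnd_cohomologyPullback_of_mem k M (globalEmbedding n K)
    (𝒰.level_antitone hb le_rfl) hl (fun _ hy => 𝒰.conj_mem_level hb hbc hl hy) i x

/-- **`tr ∘ res = [U(b',c) : U(b,c)]` on `H^i(X_{U(b',c)}, M)`** (`b' ≤ b`).
[cite: Brown1982CohomologyGroups, Ch. III, Prop. 9.5 (ii)] [cite: Hida1994AIF, §2 (proof of Thm. 2.2)] -/
theorem heckeOperator₂_one_cohomologyPullback_level_apply {b b' c : ℕ} (hb : b' ≤ b) (i : ℕ)
    (x : ArithmeticQuotient.cohomology k (globalEmbedding n K) (𝒰.level b' c) M i) :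
    (ArithmeticQuotient.heckeOperator₂ k (𝒰.level b' c) (𝒰.level b c) 1 M (globalEmbedding n K) i).hom
        ((ArithmeticQuotient.cohomologyPullback k (globalEmbedding n K) M
          (𝒰.level_antitone hb le_rfl) i).hom x) =
      (𝒰.level b c).relIndex (𝒰.level b' c) • x :=
  ArithmeticQuotient.heckeOperator₂_one_cohomologyPullback_apply k _ _ M (globalEmbedding n K) _ i x

/-- **`res ∘ tr = ∑_{s ∈ S} T_s` on `H^i(X_{U(b,c)}, M)`** for `b' ≤ b ≤ c` and any transversal `S`
of `U(b', c)/U(b, c)` (e.g. diamond elements `⟨u⟩`, `u` running over `T(b')/T(b)`): the norm of the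
`U(b',c)/U(b,c)`-action. [cite: Brown1982CohomologyGroups, Ch. III, Prop. 9.5 (iii)]
[cite: KhareThorne2017, §6.3] -/
theorem heckeOperator₂_one_comp_cohomologyPullback_level {b b' c : ℕ} (hb : b' ≤ b) (hbc : b ≤ c)
    (S : Finset (FiniteAdelicGL n K))
    (hS : Set.BijOn (fun s : FiniteAdelicGL n K => (s : FiniteAdelicGL n K ⧸ 𝒰.level b c)) S
      (ArithmeticQuotient.doubleCosetQuot₂ (𝒰.level b' c) (𝒰.level b c) 1)) (i : ℕ) :
    ArithmeticQuotient.heckeOperator₂ k (𝒰.level b' c) (𝒰.level b c) 1 M (globalEmbedding n K) i ≫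
        ArithmeticQuotient.cohomologyPullback k (globalEmbedding n K) M (𝒰.level_antitone hb le_rfl) i =
      ∑ s ∈ S, ArithmeticQuotient.heckeOperator k (𝒰.level b c) s M (globalEmbedding n K) i :=
  ArithmeticQuotient.heckeOperator₂_one_comp_cohomologyPullback k _ _ M (globalEmbedding n K) _
    (fun _ hl _ hy => 𝒰.conj_mem_level hb hbc hl hy) S hS i

/-- **Kernel and cokernel of `res : H^i(X_{U(b',c)}, M) → H^i(X_{U(b,c)}, M)^{U(b',c)/U(b,c)}` are
killed by the index** (`b' ≤ b ≤ c`): an invariant class `y` has `[U(b',c) : U(b,c)] • y ∈ range res`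
(and `ker res` is killed by the index, `relIndex_smul_eq_zero_of_cohomologyPullback_eq_zero`) — the
mechanism of "`res` has finite kernel and cokernel" in [cite: Hida1994AIF, §2 (proof of Thm. 2.2)]
([cite: Hida1993Duke, Thm. 5.1]). [cite: Brown1982CohomologyGroups, Ch. III, Prop. 9.5, 10.1] -/
theorem relIndex_smul_mem_range_cohomologyPullback_level {b b' c : ℕ} (hb : b' ≤ b) (hbc : b ≤ c)
    (S : Finset (FiniteAdelicGL n K))
    (hS : Set.BijOn (fun s : FiniteAdelicGL n K => (s : FiniteAdelicGL n K ⧸ 𝒰.level b c)) S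
      (ArithmeticQuotient.doubleCosetQuot₂ (𝒰.level b' c) (𝒰.level b c) 1)) (i : ℕ)
    {y : ArithmeticQuotient.cohomology k (globalEmbedding n K) (𝒰.level b c) M i}
    (hy : ∀ s ∈ S, ArithmeticQuotient.heckeEnd k (𝒰.level b c) s M (globalEmbedding n K) i y = y) :
    (𝒰.level b c).relIndex (𝒰.level b' c) • y ∈
      LinearMap.range (ArithmeticQuotient.cohomologyPullback k (globalEmbedding n K) M
        (𝒰.level_antitone hb le_rfl) i).hom :=
  ArithmeticQuotient.relIndex_smul_mem_range_cohomologyPullback k _ _ M (globalEmbedding n K) _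
    (fun _ hl _ hy' => 𝒰.conj_mem_level hb hbc hl hy') S hS i hy

/-- On `H^i(X_{U(b,c)}, M)` the operator `T_s` of `s ∈ U(b', c)` (`b' ≤ b ≤ c`) with
`s ≡ ⟨u⟩_v mod U(b, c)` IS the diamond operator `⟨u⟩_v` (`U` maximal above `p`, `v ∣ p`).
[cite: KhareThorne2017, §6.3] -/
theorem heckeEnd_level_eq_diamond {b b' c : ℕ} (hb : b' ≤ b) (hbc : b ≤ c) (h𝒰 : 𝒰.IsMaximalAbove)
    {v : HeightOneSpectrum (𝓞 K)} (hv : (p : 𝓞 K) ∈ v.asIdeal) {s : FiniteAdelicGL n K}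
    (hs : s ∈ 𝒰.level b' c) (u : Fin n → (v.adicCompletionIntegers K)ˣ)
    (hsu : (s : FiniteAdelicGL n K ⧸ 𝒰.level b c) = diamondElement n K v u) (i : ℕ) :
    ArithmeticQuotient.heckeEnd k (𝒰.level b c) s M (globalEmbedding n K) i =
      ArithmeticQuotient.heckeEnd k (𝒰.level b c) (diamondElement n K v u) M (globalEmbedding n K) i :=
  ArithmeticQuotient.heckeEnd_eq_of_coe_eq k M (globalEmbedding n K)
    (fun _ hy => 𝒰.conj_mem_level hb hbc hs hy)
    (fun _ hy => 𝒰.diamondElement_conj_mem_level h𝒰 hv u b c hy) hsu i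

end BigHeckeGLn.TameLevel

end Literature.NumberTheory.Automorphic
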